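import Summits.ValiantsHypothesis.ValiantsHypothesis.Theorems.LacunarySymmetroidMatrixDescartesDoorA26WallBubblingSignWord

/-!
# `DoorA26` / line `wall_bubbling` — the EVENTUAL-SIGNS LIFT FORMAT (any one-parameter family of letters, abscissae moving with the parameter)

HONEST FRAMING.  Object-search cell `pub-symmetroid`, crux `Theses.LacunarySymmetroid.DoorA26` (stmt-ValiantsHypothesis-19979; OPEN, typed,
never asserted).  W2 seat val-sym-door-p1 g19, file #69; def-free helper for obligation (R) of `Cruxes/DoorA26/Lines/wall_bubbling.lean`.
WHY.  The lifts in the tree perturb LINEARLY (`S_l ↦ S_l + ηT_l`: #43/#44/#46 at fixed abscissae, #49/#50 at a triple zero).  Memo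
`DOOR-A26-P1G19-NO-BALANCE.md` §7d/§7g shows that from ORDER 4 on linear families provably fail (inside-type quadruple zero) while SECOND-ORDER
families `S_l + ηT₁_l + η²T₂_l` succeed, and that the sign checks for an opening multiple zero sit at abscissae MOVING with `η` (`t⋆ ± η^{1/2}σ`).
This file states the format once for all such arguments: ANY family `η ↦ Sη η` of symmetric letters and ANY family of 21 increasing abscissae
`τ η`, with the alternating target signs `κ` attained EVENTUALLY as `η → 0⁺` at each abscissa, put `δ` in the twenty-locus (pick one small `η`;
g17's `le_ncard_of_alternations_exp`).  Plus the one asymptotic helper every user needs (`η^m · g(η)` with `g → L`, `κL > 0`, is eventually `κ`-signed).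

WHAT IS HERE.  `mul_neg_of_kappa_signs`; ★ `mem_twentyLocus_of_eventually_alternating` (moving abscissae) and its fixed-abscissae corollary
`mem_twentyLocus_of_eventually_signs`; `eventually_kappa_pos_pow_mul`.  Nothing here bears on `DoorA26`, `DoorA34`, (W)/(M)/(R), `MatrixDescartes`
(18050) or `VP ≠ VNP`; registers unchanged.

[folklore] intermediate value theorem / finite intersections of neighbourhoods.  [this work] the packaging.
-/

set_option linter.dupNamespace false

namespace Summit.ValiantsHypothesis.ValiantsHypothesis.Theorems.LacunarySymmetroidMatrixDescartes.WallBubbling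

open Finset Filter Topology
open Bubbling (TwentyLocus)
open Census.RealExp (ncard_rpow_eq_ncard_exp)

/-- Sign transfer: `κ_a a > 0`, `κ_b b > 0`, `κ_a κ_b < 0` ⇒ `a b < 0`. [folklore] -/
theorem mul_neg_of_kappa_signs {a b κa κb : ℝ} (ha : 0 < κa * a) (hb : 0 < κb * b) (hκ : κa * κb < 0) : a * b < 0 := by
  by_contra h
  push Not at h
  nlinarith [mul_pos ha hb, mul_nonneg (neg_nonneg.2 hκ.le) h]

/-- ★ **EVENTUAL-SIGNS LIFT, moving abscissae.**  A family of symmetric letters `Sη η` on the exponents `δ` and a family of 21 abscissae `τ η`,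
strictly increasing for all small `η > 0`; if at each abscissa the determinant eventually (as `η → 0⁺`) has the prescribed sign `κ_j`, with `κ` alternating, then
`δ ∈ TwentyLocus`: one small `η` realises all 21 signs, hence 20 sign changes, hence 20 zeros. [this work] -/
theorem mem_twentyLocus_of_eventually_alternating (δ : Fin 6 → ℝ) (Sη : ℝ → Fin 6 → Matrix (Fin 2) (Fin 2) ℝ)
    (hS : ∀ η l, (Sη η l).IsSymm) (τ : ℝ → Fin 21 → ℝ) (hτ : ∀ᶠ η in 𝓝[>] (0 : ℝ), StrictMono (τ η)) (κ : Fin 21 → ℝ)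
    (halt : ∀ j : Fin 20, κ j.castSucc * κ j.succ < 0)
    (hsign : ∀ j, ∀ᶠ η in 𝓝[>] (0 : ℝ), 0 < κ j * (∑ l, Real.exp (δ l * τ η j) • Sη η l).det) :
    δ ∈ TwentyLocus := by
  obtain ⟨η, hη, hτη⟩ := ((eventually_all.2 hsign).and hτ).exists
  have halt' : ∀ j : Fin 20, (∑ l, Real.exp (δ l * τ η j.castSucc) • Sη η l).det *
      (∑ l, Real.exp (δ l * τ η j.succ) • Sη η l).det < 0 :=
    fun j => mul_neg_of_kappa_signs (hη j.castSucc) (hη j.succ) (halt j)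
  refine ⟨Sη η, fun l => hS η l, ?_⟩
  rw [ncard_rpow_eq_ncard_exp]
  exact (le_ncard_of_alternations_exp δ (Sη η) (by norm_num) (τ η) hτη halt').2

/-- **EVENTUAL-SIGNS LIFT, fixed abscissae** (the special case `τ η = τ`). [this work] -/
theorem mem_twentyLocus_of_eventually_signs (δ : Fin 6 → ℝ) (Sη : ℝ → Fin 6 → Matrix (Fin 2) (Fin 2) ℝ)
    (hS : ∀ η l, (Sη η l).IsSymm) (τ : Fin 21 → ℝ) (hτ : StrictMono τ) (κ : Fin 21 → ℝ)
    (halt : ∀ j : Fin 20, κ j.castSucc * κ j.succ < 0)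
    (hsign : ∀ j, ∀ᶠ η in 𝓝[>] (0 : ℝ), 0 < κ j * (∑ l, Real.exp (δ l * τ j) • Sη η l).det) :
    δ ∈ TwentyLocus :=
  mem_twentyLocus_of_eventually_alternating δ Sη hS (fun _ => τ) (Eventually.of_forall fun _ => hτ) κ halt hsign

/-- The asymptotic helper: if `g → L` along `η → 0⁺` and `κ L > 0` then `κ · (η^m g(η)) > 0` eventually. [folklore] -/
theorem eventually_kappa_pos_pow_mul {g : ℝ → ℝ} {L κ : ℝ} (m : ℕ) (hg : Tendsto g (𝓝[>] 0) (𝓝 L)) (hκ : 0 < κ * L) :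
    ∀ᶠ η in 𝓝[>] (0 : ℝ), 0 < κ * (η ^ m * g η) := by
  have h1 : ∀ᶠ η in 𝓝[>] (0 : ℝ), 0 < κ * g η := (hg.const_mul κ).eventually (eventually_gt_nhds hκ)
  have h2 : ∀ᶠ η in 𝓝[>] (0 : ℝ), 0 < η := eventually_mem_nhdsWithin
  filter_upwards [h1, h2] with η hη hpos
  have : κ * (η ^ m * g η) = η ^ m * (κ * g η) := by ring
  rw [this]
  exact mul_pos (pow_pos hpos m) hη

end Summit.ValiantsHypothesis.ValiantsHypothesis.Theorems.LacunarySymmetroidMatrixDescartes.WallBubbling
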